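import Literature.NumberTheory.Transcendental.SlabCharts
import Mathlib.MeasureTheory.Function.Jacobian
import Mathlib.MeasureTheory.Constructions.Pi
import HarnessLib

/-!
# Dyadic localisation and ramification of base charts

Two coordinatewise reparametrisations of the unit cube used before applying the Abhyankar–Jung
theorem along a base chart `φ : ℝᵈ → ℝᵈ` (Jung's method): the **dyadic corner maps**
`ψ_c(y)_i = y_i / 2` (`c_i = false`) or `1 − y_i / 2` (`c_i = true`), `c ∈ {false, true}ᵈ`, whose
open-cube images tile the open cube up to the null hyperplanes `y_i = 1/2` and move every far face
`x_i = 1` away from the closed cube, and the **ramification** `σ ↦ (σ_i^N)_i`, `N ≥ 1`, a bijection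
of the open cube. For a chart `φ` in the tree's FORMAT (analytic at the closed cube;
`ℚ`-semialgebraic, injective, Jacobian `≠ 0` on the open cube):

* `hasFDerivAt_coordinatewise` — derivative and Jacobian `∏ g_i'(s_i)` of a coordinatewise map;
* `dyadicRamified_format` — `φ ∘ ψ_c ∘ (·)^N` is again of FORMAT;
* `image_dyadic_subset`, `disjoint_image_dyadic`, `image_pow_eq` — images;
* `volume_image_diff_iUnion_dyadic_eq_zero` — `φ((0,1)ᵈ)` is covered by the `φ(ψ_c((0,1)ᵈ))` up
  to a null set;
* `cubeMonomial_comp_dyadicRamified` — a cube-monomial times a unit,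
  `(∏ x_i^{a_i} (1 − x_i)^{b_i}) · e(x)`, becomes along `ψ_c ∘ (·)^N` a PURE monomial
  `(∏ σ_i^{N a'_i}) · e'(σ)` with `e'` analytic and nowhere zero near the closed cube
  (`a'_i = b_i` if `c_i` else `a_i`).

References: J. Kollár, *Lectures on Resolution of Singularities* (2007), §2.3; E. Bierstone,
P. Milman, Publ. Math. IHÉS 67 (1988), §4 (dyadic/ramified localisations, real-analytic setting).
-/

noncomputable section

open Set MeasureTheory
open Literature.ModelTheory.ExponentialFields

namespace Literature.NumberTheory.Transcendental

variable {d : ℕ}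

/-- **Derivative of a coordinatewise map.** If `g_i` has derivative `g_i'` at `s_i` for every `i`,
then `s ↦ (g_i (s_i))_i` has at `s` the diagonal derivative `v ↦ (g_i' v_i)_i`, of determinant
`∏ g_i'`. [folklore] -/
theorem hasFDerivAt_coordinatewise {g : Fin d → ℝ → ℝ} {g' : Fin d → ℝ} {s : Fin d → ℝ}
    (hg : ∀ i, HasDerivAt (g i) (g' i) (s i)) :
    ∃ L : (Fin d → ℝ) →L[ℝ] (Fin d → ℝ), HasFDerivAt (fun s i => g i (s i)) L s ∧
      (∀ v, L v = fun i => g' i * v i) ∧ L.det = ∏ i, g' i := by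
  classical
  set L : (Fin d → ℝ) →L[ℝ] (Fin d → ℝ) :=
    LinearMap.toContinuousLinearMap (Matrix.toLin' (Matrix.diagonal g')) with hL
  have hLapply : ∀ v, L v = fun i => g' i * v i := fun v => by
    ext i
    simp [hL, Matrix.mulVec_diagonal]
  refine ⟨L, hasFDerivAt_pi'' fun i => ?_, hLapply, by simp [hL, LinearMap.det_toLin', Matrix.det_diagonal]⟩
  have h1 := (hg i).comp_hasFDerivAt s (hasFDerivAt_apply (𝕜 := ℝ) i s)
  have he : (ContinuousLinearMap.proj i).comp L =
      g' i • (ContinuousLinearMap.proj i : (Fin d → ℝ) →L[ℝ] ℝ) := by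
    ext v
    simp [hLapply]
  rw [he]
  exact h1

/-- A coordinatewise map built from analytic functions is analytic. [folklore] -/
theorem analyticAt_coordinatewise {g : Fin d → ℝ → ℝ} {s : Fin d → ℝ}
    (hg : ∀ i, AnalyticAt ℝ (g i) (s i)) : AnalyticAt ℝ (fun s i => g i (s i)) s :=
  analyticAt_pi_iff.2 fun i =>
    AnalyticAt.comp (g := g i) (f := fun s : Fin d → ℝ => s i) (x := s) (hg i)
      ((ContinuousLinearMap.proj (R := ℝ) (φ := fun _ : Fin d => ℝ) i).analyticAt s)

/-- The determinant of a composite of continuous linear endomorphisms is the product of the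
determinants. [folklore] -/
theorem det_comp_clm {n : ℕ} (A B : (Fin n → ℝ) →L[ℝ] (Fin n → ℝ)) :
    (A.comp B).det = A.det * B.det := by
  rw [ContinuousLinearMap.det, ContinuousLinearMap.det, ContinuousLinearMap.det,
    ← LinearMap.det_comp]
  rfl

section Maps

variable (c : Fin d → Bool) (N : ℕ) (ψ pw : (Fin d → ℝ) → (Fin d → ℝ))

/-- The dyadic corner map sends the closed cube into the closed cube. [folklore] -/
theorem dyadic_mapsTo_Icc (hψ : ∀ y i, ψ y i = if c i then 1 - y i / 2 else y i / 2) :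
    MapsTo ψ (Set.pi Set.univ (fun _ : Fin d => Icc (0 : ℝ) 1))
      (Set.pi Set.univ (fun _ : Fin d => Icc (0 : ℝ) 1)) := by
  intro y hy i _
  have h := hy i (mem_univ _)
  rw [hψ]
  split_ifs <;> constructor <;> linarith [h.1, h.2]

/-- The dyadic corner map sends the open cube into the open cube. [folklore] -/
theorem dyadic_mapsTo_Ioo (hψ : ∀ y i, ψ y i = if c i then 1 - y i / 2 else y i / 2) :
    MapsTo ψ (Set.pi Set.univ (fun _ : Fin d => Ioo (0 : ℝ) 1))
      (Set.pi Set.univ (fun _ : Fin d => Ioo (0 : ℝ) 1)) := by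
  intro y hy i _
  have h := hy i (mem_univ _)
  rw [hψ]
  split_ifs <;> constructor <;> linarith [h.1, h.2]

/-- The dyadic corner map is injective. [folklore] -/
theorem dyadic_injective (hψ : ∀ y i, ψ y i = if c i then 1 - y i / 2 else y i / 2) :
    Function.Injective ψ := by
  intro y y' h
  funext i
  have hi := congrFun h i
  rw [hψ, hψ] at hi
  split_ifs at hi <;> linarith

/-- The ramification sends the closed cube into the closed cube. [folklore] -/
theorem pow_mapsTo_Icc (hpw : ∀ σ i, pw σ i = σ i ^ N) :
    MapsTo pw (Set.pi Set.univ (fun _ : Fin d => Icc (0 : ℝ) 1))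
      (Set.pi Set.univ (fun _ : Fin d => Icc (0 : ℝ) 1)) := by
  intro σ hσ i _
  have h := hσ i (mem_univ _)
  rw [hpw]
  exact ⟨pow_nonneg h.1 _, pow_le_one₀ h.1 h.2⟩

/-- The ramification (`N ≥ 1`) sends the open cube into the open cube. [folklore] -/
theorem pow_mapsTo_Ioo (hN : 0 < N) (hpw : ∀ σ i, pw σ i = σ i ^ N) :
    MapsTo pw (Set.pi Set.univ (fun _ : Fin d => Ioo (0 : ℝ) 1))
      (Set.pi Set.univ (fun _ : Fin d => Ioo (0 : ℝ) 1)) := by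
  intro σ hσ i _
  have h := hσ i (mem_univ _)
  rw [hpw]
  exact ⟨pow_pos h.1 _, pow_lt_one₀ h.1.le h.2 hN.ne'⟩

/-- The ramification (`N ≥ 1`) maps the open cube ONTO the open cube. [folklore] -/
theorem image_pow_eq (hN : 0 < N) (hpw : ∀ σ i, pw σ i = σ i ^ N) :
    pw '' Set.pi Set.univ (fun _ : Fin d => Ioo (0 : ℝ) 1) =
      Set.pi Set.univ (fun _ : Fin d => Ioo (0 : ℝ) 1) := by
  refine (pow_mapsTo_Ioo N pw hN hpw).image_subset.antisymm fun x hx => ?_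
  refine ⟨fun i => x i ^ ((N : ℝ)⁻¹), fun i _ => ?_, funext fun i => ?_⟩
  · have h := hx i (mem_univ _)
    exact ⟨Real.rpow_pos_of_pos h.1 _,
      Real.rpow_lt_one h.1.le h.2 (inv_pos.2 (by exact_mod_cast hN))⟩
  · have h := hx i (mem_univ _)
    rw [hpw, ← Real.rpow_natCast, ← Real.rpow_mul h.1.le,
      inv_mul_cancel₀ (by exact_mod_cast hN.ne'), Real.rpow_one]

/-- The ramification (`N ≥ 1`) is injective on the open cube. [folklore] -/
theorem pow_injOn (hN : 0 < N) (hpw : ∀ σ i, pw σ i = σ i ^ N) :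
    InjOn pw (Set.pi Set.univ (fun _ : Fin d => Ioo (0 : ℝ) 1)) := by
  intro σ hσ σ' hσ' h
  funext i
  have hi := congrFun h i
  rw [hpw, hpw] at hi
  exact (pow_left_inj₀ (hσ i (mem_univ _)).1.le (hσ' i (mem_univ _)).1.le hN.ne').1 hi

/-- Open-cube images of distinct dyadic corner maps are disjoint. [folklore] -/
theorem disjoint_image_dyadic {c c' : Fin d → Bool} (hcc' : c ≠ c') {ψ ψ' : (Fin d → ℝ) → (Fin d → ℝ)}
    (hψ : ∀ y i, ψ y i = if c i then 1 - y i / 2 else y i / 2)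
    (hψ' : ∀ y i, ψ' y i = if c' i then 1 - y i / 2 else y i / 2) :
    Disjoint (ψ '' Set.pi Set.univ (fun _ : Fin d => Ioo (0 : ℝ) 1))
      (ψ' '' Set.pi Set.univ (fun _ : Fin d => Ioo (0 : ℝ) 1)) := by
  obtain ⟨i, hi⟩ := Function.ne_iff.1 hcc'
  refine disjoint_left.2 ?_
  rintro _ ⟨y, hy, rfl⟩ ⟨y', hy', heq⟩
  have h := congrFun heq i
  have h1 := hy i (mem_univ _)
  have h2 := hy' i (mem_univ _)
  rw [hψ, hψ'] at h
  rcases Bool.eq_false_or_eq_true (c i) with hc | hc <;>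
    rcases Bool.eq_false_or_eq_true (c' i) with hc' | hc' <;>
    simp [hc, hc'] at h hi <;> linarith [h1.1, h1.2, h2.1, h2.2]

/-- The open cube is covered by the open-cube images of the dyadic corner maps up to the
hyperplanes `y_i = 1/2`. [folklore] -/
theorem diff_iUnion_image_dyadic_subset (ψ : (Fin d → Bool) → (Fin d → ℝ) → (Fin d → ℝ))
    (hψ : ∀ c y i, ψ c y i = if c i then 1 - y i / 2 else y i / 2) :
    Set.pi Set.univ (fun _ : Fin d => Ioo (0 : ℝ) 1) \
        ⋃ c, ψ c '' Set.pi Set.univ (fun _ : Fin d => Ioo (0 : ℝ) 1) ⊆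
      ⋃ i : Fin d, {y : Fin d → ℝ | y i = 2⁻¹} := by
  intro y hy
  by_contra hne
  simp only [mem_iUnion, mem_setOf_eq, not_exists] at hne
  apply hy.2
  refine mem_iUnion.2 ⟨fun i => decide (2⁻¹ < y i), fun i => if 2⁻¹ < y i then 2 * (1 - y i) else 2 * y i,
    fun i _ => ?_, funext fun i => ?_⟩
  · have h := hy.1 i (mem_univ _)
    show (if 2⁻¹ < y i then 2 * (1 - y i) else 2 * y i) ∈ Ioo (0 : ℝ) 1
    split_ifs with hlt
    · constructor <;> nlinarith [h.2]
    · have : y i < 2⁻¹ := lt_of_le_of_ne (not_lt.1 hlt) (hne i)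
      constructor <;> nlinarith [h.1]
  · rw [hψ]
    by_cases hlt : 2⁻¹ < y i
    · simp only [hlt, decide_true, if_true]
      ring
    · simp only [hlt, decide_false, if_false, Bool.false_eq_true]
      ring

end Maps

/-! ### The dyadic–ramified chart `φ ∘ ψ_c ∘ (·)^N` -/

section Chart

variable (c : Fin d → Bool) (N : ℕ) (φ ψ pw χ : (Fin d → ℝ) → (Fin d → ℝ))

/-- **Format of the dyadic–ramified chart.** If `φ` is analytic at the closed unit cube and
`ℚ`-semialgebraic, injective and with non-vanishing Jacobian on the open unit cube, then so is
`χ = φ ∘ ψ_c ∘ (·)^N` (`N ≥ 1`), and `χ((0,1)ᵈ) = φ(ψ_c((0,1)ᵈ))`. [folklore] -/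
theorem dyadicRamified_format (hN : 0 < N)
    (hψ : ∀ y i, ψ y i = if c i then 1 - y i / 2 else y i / 2) (hpw : ∀ σ i, pw σ i = σ i ^ N)
    (hχ : ∀ σ, χ σ = φ (ψ (pw σ)))
    (hφa : AnalyticOnNhd ℝ φ (Set.pi Set.univ (fun _ : Fin d => Icc (0 : ℝ) 1)))
    (hφs : IsSemialgebraicMapOn ℚ (Set.pi Set.univ (fun _ : Fin d => Ioo (0 : ℝ) 1)) φ)
    (hφi : InjOn φ (Set.pi Set.univ (fun _ : Fin d => Ioo (0 : ℝ) 1)))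
    (hφd : ∀ x ∈ Set.pi Set.univ (fun _ : Fin d => Ioo (0 : ℝ) 1), (fderiv ℝ φ x).det ≠ 0) :
    (AnalyticOnNhd ℝ χ (Set.pi Set.univ (fun _ : Fin d => Icc (0 : ℝ) 1)) ∧
      IsSemialgebraicMapOn ℚ (Set.pi Set.univ (fun _ : Fin d => Ioo (0 : ℝ) 1)) χ ∧
      InjOn χ (Set.pi Set.univ (fun _ : Fin d => Ioo (0 : ℝ) 1)) ∧
      ∀ x ∈ Set.pi Set.univ (fun _ : Fin d => Ioo (0 : ℝ) 1), (fderiv ℝ χ x).det ≠ 0) ∧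
    χ '' Set.pi Set.univ (fun _ : Fin d => Ioo (0 : ℝ) 1) =
      φ '' (ψ '' Set.pi Set.univ (fun _ : Fin d => Ioo (0 : ℝ) 1)) := by
  have hχfun : χ = φ ∘ ψ ∘ pw := funext fun σ => hχ σ
  have hψfun : ψ = fun y i => (fun i (t : ℝ) => if c i then 1 - t / 2 else t / 2) i (y i) :=
    funext fun y => funext fun i => hψ y i
  have hpwfun : pw = fun σ i => (fun _ (t : ℝ) => t ^ N) i (σ i) :=
    funext fun σ => funext fun i => hpw σ i
  -- analyticity of the two inner maps (everywhere)
  have hψa : ∀ y, AnalyticAt ℝ ψ y := fun y => by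
    rw [hψfun]
    refine analyticAt_coordinatewise (g := fun i (t : ℝ) => if c i then 1 - t / 2 else t / 2)
      fun i => ?_
    split_ifs
    · exact analyticAt_const.sub (analyticAt_id.div analyticAt_const two_ne_zero)
    · exact analyticAt_id.div analyticAt_const two_ne_zero
  have hpwa : ∀ σ, AnalyticAt ℝ pw σ := fun σ => by
    rw [hpwfun]
    exact analyticAt_coordinatewise (g := fun _ (t : ℝ) => t ^ N) fun i => analyticAt_id.pow N
  -- derivatives and Jacobians of the inner maps
  have hψd : ∀ y, ∃ L : (Fin d → ℝ) →L[ℝ] (Fin d → ℝ), HasFDerivAt ψ L y ∧ L.det ≠ 0 := fun y => by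
    obtain ⟨L, hL, -, hdet⟩ := hasFDerivAt_coordinatewise (s := y)
      (g := fun i (t : ℝ) => if c i then 1 - t / 2 else t / 2)
      (g' := fun i => if c i then -2⁻¹ else 2⁻¹) (fun i => by
        cases hci : c i
        · simpa [hci] using (hasDerivAt_id (y i)).div_const 2
        · simpa [hci] using ((hasDerivAt_id (y i)).div_const 2).const_sub 1)
    refine ⟨L, hψfun ▸ hL, ?_⟩
    rw [hdet]
    exact Finset.prod_ne_zero_iff.2 fun i _ => by split_ifs <;> norm_num
  have hpwd : ∀ σ ∈ Set.pi Set.univ (fun _ : Fin d => Ioo (0 : ℝ) 1),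
      ∃ L : (Fin d → ℝ) →L[ℝ] (Fin d → ℝ), HasFDerivAt pw L σ ∧ L.det ≠ 0 := fun σ hσ => by
    obtain ⟨L, hL, -, hdet⟩ := hasFDerivAt_coordinatewise (s := σ) (g := fun _ (t : ℝ) => t ^ N)
      (g' := fun i => (N : ℝ) * σ i ^ (N - 1)) (fun i => by simpa using hasDerivAt_pow N (σ i))
    refine ⟨L, hpwfun ▸ hL, ?_⟩
    rw [hdet]
    exact Finset.prod_ne_zero_iff.2 fun i _ =>
      mul_ne_zero (by exact_mod_cast hN.ne') (pow_ne_zero _ (hσ i (mem_univ _)).1.ne')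
  have hin : ∀ σ ∈ Set.pi Set.univ (fun _ : Fin d => Ioo (0 : ℝ) 1),
      ψ (pw σ) ∈ Set.pi Set.univ (fun _ : Fin d => Ioo (0 : ℝ) 1) := fun σ hσ =>
    dyadic_mapsTo_Ioo c ψ hψ (pow_mapsTo_Ioo N pw hN hpw hσ)
  refine ⟨⟨fun σ hσ => ?_, ?_, ?_, fun σ hσ => ?_⟩, ?_⟩
  · rw [hχfun]
    exact AnalyticAt.comp (f := ψ ∘ pw) (x := σ)
      (hφa _ (dyadic_mapsTo_Icc c ψ hψ (pow_mapsTo_Icc N pw hpw hσ)))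
      ((hψa (pw σ)).comp (hpwa σ))
  · -- semialgebraic: `ψ ∘ pw` is a polynomial map over `ℚ`
    have hO := isSemialgebraic_pi_Ioo_unit d
    have hpoly : IsSemialgebraicMapOn ℚ (Set.pi Set.univ (fun _ : Fin d => Ioo (0 : ℝ) 1))
        (ψ ∘ pw) := by
      refine (isSemialgebraicMapOn_aeval hO (fun i => if c i then
        1 - MvPolynomial.C (2⁻¹ : ℚ) * MvPolynomial.X i ^ N
        else MvPolynomial.C (2⁻¹ : ℚ) * MvPolynomial.X i ^ N)).congr fun σ _ => ?_
      funext i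
      simp only [Function.comp_apply, hψ, hpw]
      split_ifs <;> simp [div_eq_inv_mul]
    rw [hχfun]
    exact IsSemialgebraicMapOn.comp_holds hφs hpoly fun σ hσ => hin σ hσ
  · rw [hχfun]
    exact hφi.comp ((dyadic_injective c ψ hψ).comp_injOn (pow_injOn N pw hN hpw)) fun σ hσ => hin σ hσ
  · obtain ⟨L₁, hL₁, hd₁⟩ := hpwd σ hσ
    obtain ⟨L₂, hL₂, hd₂⟩ := hψd (pw σ)
    have hφ' : HasFDerivAt φ (fderiv ℝ φ (ψ (pw σ))) (ψ (pw σ)) :=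
      (hφa _ (pi_Ioo_subset_pi_Icc d (hin σ hσ))).differentiableAt.hasFDerivAt
    have hcomp : HasFDerivAt χ ((fderiv ℝ φ (ψ (pw σ))).comp (L₂.comp L₁)) σ := by
      rw [hχfun]
      exact hφ'.comp σ (hL₂.comp σ hL₁)
    rw [hcomp.fderiv, det_comp_clm, det_comp_clm]
    exact mul_ne_zero (hφd _ (hin σ hσ)) (mul_ne_zero hd₂ hd₁)
  · rw [hχfun, Set.image_comp, Set.image_comp, image_pow_eq N pw hN hpw]

/-- Open-cube images of the dyadic–ramified charts for distinct corners are disjoint (injectivity of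
`φ` on the open cube). [folklore] -/
theorem disjoint_image_dyadicRamified {c c' : Fin d → Bool} (hcc' : c ≠ c')
    {ψ ψ' : (Fin d → ℝ) → (Fin d → ℝ)}
    (hψ : ∀ y i, ψ y i = if c i then 1 - y i / 2 else y i / 2)
    (hψ' : ∀ y i, ψ' y i = if c' i then 1 - y i / 2 else y i / 2)
    (hφi : InjOn φ (Set.pi Set.univ (fun _ : Fin d => Ioo (0 : ℝ) 1))) :
    Disjoint (φ '' (ψ '' Set.pi Set.univ (fun _ : Fin d => Ioo (0 : ℝ) 1)))
      (φ '' (ψ' '' Set.pi Set.univ (fun _ : Fin d => Ioo (0 : ℝ) 1))) := by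
  have h := disjoint_image_dyadic hcc' hψ hψ'
  refine disjoint_left.2 ?_
  rintro _ ⟨y, hy, rfl⟩ ⟨y', hy', heq⟩
  have hyO : y ∈ Set.pi Set.univ (fun _ : Fin d => Ioo (0 : ℝ) 1) := by
    obtain ⟨z, hz, rfl⟩ := hy
    exact dyadic_mapsTo_Ioo c ψ hψ hz
  have hy'O : y' ∈ Set.pi Set.univ (fun _ : Fin d => Ioo (0 : ℝ) 1) := by
    obtain ⟨z, hz, rfl⟩ := hy'
    exact dyadic_mapsTo_Ioo c' ψ' hψ' hz
  have : y' = y := hφi hy'O hyO heq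
  subst this
  exact disjoint_left.1 h hy hy'

/-- **The dyadic images exhaust `φ((0,1)ᵈ)` up to a null set**: if `φ` is differentiable at the
points of the open cube then `φ((0,1)ᵈ) ∖ ⋃_c φ(ψ_c((0,1)ᵈ))` is Lebesgue-null (it lies in the
image of the null hyperplanes `y_i = 1/2`). [folklore] -/
theorem volume_image_diff_iUnion_dyadic_eq_zero (Ψ : (Fin d → Bool) → (Fin d → ℝ) → (Fin d → ℝ))
    (hΨ : ∀ c y i, Ψ c y i = if c i then 1 - y i / 2 else y i / 2)
    (hφ : ∀ x ∈ Set.pi Set.univ (fun _ : Fin d => Ioo (0 : ℝ) 1), DifferentiableAt ℝ φ x) :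
    volume ((φ '' Set.pi Set.univ (fun _ : Fin d => Ioo (0 : ℝ) 1)) \
      ⋃ c, φ '' (Ψ c '' Set.pi Set.univ (fun _ : Fin d => Ioo (0 : ℝ) 1))) = 0 := by
  have hsub : (φ '' Set.pi Set.univ (fun _ : Fin d => Ioo (0 : ℝ) 1)) \
        (⋃ c, φ '' (Ψ c '' Set.pi Set.univ (fun _ : Fin d => Ioo (0 : ℝ) 1))) ⊆
      φ '' (Set.pi Set.univ (fun _ : Fin d => Ioo (0 : ℝ) 1) ∩ ⋃ i : Fin d, {y | y i = 2⁻¹}) := by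
    rintro _ ⟨⟨y, hy, rfl⟩, hnot⟩
    refine ⟨y, ⟨hy, diff_iUnion_image_dyadic_subset Ψ hΨ ⟨hy, fun hmem => hnot ?_⟩⟩, rfl⟩
    obtain ⟨c, hc⟩ := mem_iUnion.1 hmem
    exact mem_iUnion.2 ⟨c, mem_image_of_mem φ hc⟩
  refine measure_mono_null hsub
    (addHaar_image_eq_zero_of_differentiableOn_of_addHaar_eq_zero volume
      (fun x hx => (hφ x hx.1).differentiableWithinAt) ?_)
  refine measure_mono_null inter_subset_right ((measure_iUnion_null_iff).2 fun i => ?_)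
  rw [volume_pi]
  exact Measure.pi_hyperplane (fun _ : Fin d => (volume : Measure ℝ)) i (2⁻¹ : ℝ)

end Chart

/-! ### Cube-monomials become pure monomials -/

/-- **Dyadic localisation and ramification of a cube-monomial.** If
`F(x) = (∏ x_i^{a_i} (1 − x_i)^{b_i}) · e(x)` on an open `U ⊇ [0,1]ᵈ` with `e` analytic and nowhere
zero on `U`, then along `x = ψ_c(σ^N)` one has `F(ψ_c(σ^N)) = (∏ σ_i^{N a'_i}) · e'(σ)` on an open
`U' ⊇ [0,1]ᵈ`, with `a'_i = b_i` if `c_i` and `a'_i = a_i` otherwise, and `e'` analytic and nowhere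
zero on `U'` (the far-face factors `1 − x_i` have become units). [folklore] -/
theorem cubeMonomial_comp_dyadicRamified (c : Fin d → Bool) (N : ℕ)
    (ψ pw : (Fin d → ℝ) → (Fin d → ℝ))
    (hψ : ∀ y i, ψ y i = if c i then 1 - y i / 2 else y i / 2) (hpw : ∀ σ i, pw σ i = σ i ^ N)
    {F e : (Fin d → ℝ) → ℝ} {U : Set (Fin d → ℝ)} (hU : IsOpen U)
    (hcube : Set.pi Set.univ (fun _ : Fin d => Icc (0 : ℝ) 1) ⊆ U) (a b : Fin d → ℕ)
    (he : AnalyticOnNhd ℝ e U) (he0 : ∀ x ∈ U, e x ≠ 0)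
    (hF : ∀ x ∈ U, F x = (∏ i, x i ^ a i * (1 - x i) ^ b i) * e x) :
    ∃ (U' : Set (Fin d → ℝ)) (e' : (Fin d → ℝ) → ℝ), IsOpen U' ∧
      Set.pi Set.univ (fun _ : Fin d => Icc (0 : ℝ) 1) ⊆ U' ∧ AnalyticOnNhd ℝ e' U' ∧
      (∀ σ ∈ U', e' σ ≠ 0) ∧
      ∀ σ ∈ U', F (ψ (pw σ)) = (∏ i, σ i ^ (N * (if c i then b i else a i))) * e' σ := by
  have hψfun : ψ = fun y i => (fun i (t : ℝ) => if c i then 1 - t / 2 else t / 2) i (y i) :=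
    funext fun y => funext fun i => hψ y i
  have hpwfun : pw = fun σ i => (fun _ (t : ℝ) => t ^ N) i (σ i) :=
    funext fun σ => funext fun i => hpw σ i
  have hψa : ∀ y, AnalyticAt ℝ ψ y := fun y => by
    rw [hψfun]
    refine analyticAt_coordinatewise (g := fun i (t : ℝ) => if c i then 1 - t / 2 else t / 2)
      fun i => ?_
    split_ifs
    · exact analyticAt_const.sub (analyticAt_id.div analyticAt_const two_ne_zero)
    · exact analyticAt_id.div analyticAt_const two_ne_zero
  have hpwa : ∀ σ, AnalyticAt ℝ pw σ := fun σ => by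
    rw [hpwfun]
    exact analyticAt_coordinatewise (g := fun _ (t : ℝ) => t ^ N) fun i => analyticAt_id.pow N
  -- the open set `U' = (ψ ∘ pw)⁻¹ U ∩ {σ | ∀ i, σ_i^N < 2}`
  set U' : Set (Fin d → ℝ) := (ψ ∘ pw) ⁻¹' U ∩ {σ | ∀ i, σ i ^ N < 2} with hU'
  have hcont : Continuous (ψ ∘ pw) :=
    continuous_iff_continuousAt.2 fun σ => ((hψa _).comp (hpwa σ)).continuousAt
  have hU'o : IsOpen U' := by
    refine (hU.preimage hcont).inter ?_
    have : {σ : Fin d → ℝ | ∀ i, σ i ^ N < 2} = ⋂ i, {σ | σ i ^ N < 2} := by ext; simp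
    rw [this]
    exact isOpen_iInter_of_finite fun i =>
      isOpen_lt ((continuous_apply i).pow N) continuous_const
  have hcubeU' : Set.pi Set.univ (fun _ : Fin d => Icc (0 : ℝ) 1) ⊆ U' := fun σ hσ =>
    ⟨hcube (dyadic_mapsTo_Icc c ψ hψ (pow_mapsTo_Icc N pw hpw hσ)), fun i => by
      have h := hσ i (mem_univ _)
      linarith [pow_le_one₀ (n := N) h.1 h.2]⟩
  -- the unit
  set e' : (Fin d → ℝ) → ℝ := fun σ =>
    (∏ i, (2⁻¹ : ℝ) ^ (if c i then b i else a i) * (1 - σ i ^ N / 2) ^ (if c i then a i else b i)) *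
      e (ψ (pw σ)) with he'
  refine ⟨U', e', hU'o, hcubeU', fun σ hσ => ?_, fun σ hσ => ?_, fun σ hσ => ?_⟩
  · refine AnalyticAt.mul ?_ ((he _ hσ.1).comp ((hψa _).comp (hpwa σ)))
    refine Finset.analyticAt_fun_prod _ fun i _ => ?_
    exact analyticAt_const.mul ((analyticAt_const.sub
      ((((ContinuousLinearMap.proj (R := ℝ) (φ := fun _ : Fin d => ℝ) i).analyticAt σ).pow N).div
        analyticAt_const two_ne_zero)).pow _)
  · refine mul_ne_zero (Finset.prod_ne_zero_iff.2 fun i _ => mul_ne_zero (pow_ne_zero _ (by norm_num))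
      (pow_ne_zero _ ?_)) (he0 _ hσ.1)
    have := hσ.2 i
    linarith
  · rw [hF (ψ (pw σ)) hσ.1]
    simp only [he']
    rw [← mul_assoc, ← Finset.prod_mul_distrib]
    congr 1
    refine Finset.prod_congr rfl fun i _ => ?_
    simp only [hψ, hpw]
    by_cases hc : c i <;> simp only [hc, if_true, if_false, Bool.false_eq_true] <;> ring

end Literature.NumberTheory.Transcendental
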